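import Literature.AnabelianGeometry.EtaleTheta.Discharge.Sec1Def17Coverings
import HarnessLib

/-!
# [EtTh] §1, Prop. 1.8 (Characteristic Nature of Coverings), reduced to its anabelian inputs

Mochizuki, *The étale theta function …*, Publ. RIMS **45** (2009), §1, Prop. 1.8, PRIMS PDF pp. 28–29
(printed 254–255) [cite: MochizukiEtTh2009, Prop 1.8 p.28]. Layer L2 of the abc-iut cell, seat
abc-iut-L2-t1 (discharge wave, node `EtTh:Prop1.8`). PROOF-ONLY companion (no `def`) of
`ConstantMultipleRigidity.lean` (`PreservesCoverings`, `Prop18`, `Prop18pm`) and `TemperedRigidity.lean`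
(`ThetaSetting.Thm16i`), over the group theory of `Discharge/Sec1Def17Coverings.lean`.

**Verdict on the node.** The printed proof of Prop. 1.8 (pp. 28–29) has four inputs that are results
of anabelian geometry, cited there and NOT provable over the interface `MuTwoSetting` (which carries
`Π^tp_C ⊇ Π^tp_X ⊇ Π^tp_Ẍ` as abstract topological groups, without the curves, cusps or `G_K`-augmentation
of `C`):
(a) the extension of `γ : Π^tp_{Ẋα} →̃ Π^tp_{Ẋβ}` (resp. `Π^tp_{Ċα} →̃ Π^tp_{Ċβ}`) to
`Γ : Π^tp_{Cα} →̃ Π^tp_{Cβ}` up to an inner automorphism — "by [SemiAnbd] Theorem 6.8, (ii), it follows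
from condition (II) [`C` is a `K`-core] that `γ` induces an isomorphism `Π^tp_{Cα} →̃ Π^tp_{Cβ}` that is
compatible with `γ`" (p. 28; condition (II) has no carrier in the tree);
(b) `Γ(Π^tp_{Xα}) = Π^tp_{Xβ}` — "`Δ^tp_X ⊆ Δ^tp_C` may be characterized as the unique open subgroup of
index 2 … whose profinite completion contains no torsion elements [AbsCusp] Lemma 2.1, (v)", with
[AbsAnab] Lemma 1.3.8 and the discreteness of `Z` (p. 28) — carried here, exactly as in
`Thm110Hypothesis`, by an isomorphism `γX : Π^tp_{Xα} →̃ Π^tp_{Xβ}` with `inclX ∘ γX = Γ ∘ inclX`;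
(c) (`Ẋ`-case only) `Γ(Π^tp_{Ċα}) = Π^tp_{Ċβ}` — "`Ẋ^log → Ċ^log` may be characterized as the quotient
by the unique automorphism of `Ẋ^log` over `C^log` that acts nontrivially on the cusps of `Ẋ^log` but
does not lie over `X^log`" (p. 28; the cusps of `Ẋ` have no carrier);
(d) Thm. 1.6 (i) for `γX`, `γX(Π^tp_{Ÿα}) = Π^tp_{Ÿβ}` — in print "since `γ` preserves the decomposition
groups of cusps of `Π^tp_X` [SemiAnbd] Theorem 6.5, (iii)" (p. 29); the named fact `ThetaSetting.Thm16i`.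
Everything else is group theory inside `Π^tp_C` and is PROVED (here and in `Sec1Def17Coverings.lean`):
* `map_eq_of_forall_eq_conj` + `MuTwoSetting.dotX_normal`/`dotC_normal` — (a) gives
  `Γ(Π^tp_{Ẋα}) = Π^tp_{Ẋβ}` (resp. `Γ(Π^tp_{Ċα}) = Π^tp_{Ċβ}`), all subgroups over `Π^tp_Ẍ` being normal;
* `MuTwoSetting.dotC_inf_range` — `Π^tp_Ċ ∩ Π^tp_X = Π^tp_Ẋ`, so (b) and `Γ(Π^tp_Ċ) = Π^tp_Ċ` give `Π^tp_Ẋ`;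
* `MuTwoSetting.map_GtpXdd_eq_of_map_GtpYdd_eq` — (d) gives `Γ(Π^tp_{Ẍα}) = Π^tp_{Ẍβ}` (under (I));
* `preservesCoverings_iff_map_dotC` — **modulo (b) and (d), "`Γ` induces an isomorphism between the
  commutative diagrams" is EQUIVALENT to `Γ(Π^tp_{Ċα}) = Π^tp_{Ċβ}`**;
* `prop18pm_of_extension` — the `Ċ`-case `Prop18pm` follows from (a), (b), (d) alone;
  `prop18_of_extension` — the `Ẋ`-case `Prop18` follows from (a), (b), (c), (d).
So `EtTh:Prop1.8` is DISCHARGED MODULO the anabelian facts (a)–(d), each an explicit hypothesis in the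
vocabulary of `ConstantMultipleRigidity.lean`; it is not dischargeable outright over the present
interfaces, and nothing here asserts it. ("A similar statement holds when `Π^tp` is replaced by `Π`":
not typed upstream, not treated.) HONEST FRAMING: typed ≠ proved; no side is taken on any disputed claim.
-/

namespace Literature.AnabelianGeometry.EtaleTheta

open Literature.AnabelianGeometry.SemiGraphs

variable {p : ℕ} [Fact p.Prime]

/-! ### An extension up to an inner automorphism preserves a normal subgroup -/

section GroupTheory

variable {G G' : Type*} [Group G] [Group G']

/-- An isomorphism `Γ : G →̃ G'` which restricts, up to the inner automorphism of `c ∈ G'`, to an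
isomorphism `γ : H →̃ H'` onto a NORMAL subgroup `H'` carries `H` onto `H'` ("induces an isomorphism …
compatible with `γ`", p. 28). [cite: MochizukiEtTh2009, Prop 1.8 p.28] -/
theorem map_eq_of_forall_eq_conj {H : Subgroup G} {H' : Subgroup G'} [hn : H'.Normal]
    (Γ : G ≃* G') (γ : H ≃* H') {c : G'} (hc : ∀ x : H, Γ x.1 = c * (γ x).1 * c⁻¹) :
    H.map Γ.toMonoidHom = H' := by
  ext y
  constructor
  · rintro ⟨x, hx, rfl⟩
    change Γ x ∈ H'
    rw [hc ⟨x, hx⟩]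
    exact hn.conj_mem _ (γ ⟨x, hx⟩).2 c
  · intro hy
    have hy' : c⁻¹ * y * c⁻¹⁻¹ ∈ H' := hn.conj_mem y hy c⁻¹
    rw [inv_inv] at hy'
    refine ⟨(γ.symm ⟨c⁻¹ * y * c, hy'⟩).1, (γ.symm ⟨c⁻¹ * y * c, hy'⟩).2, ?_⟩
    change Γ (γ.symm ⟨c⁻¹ * y * c, hy'⟩).1 = y
    rw [hc, MulEquiv.apply_symm_apply]
    change c * (c⁻¹ * y * c) * c⁻¹ = y
    group

end GroupTheory

/-! ### Degrees in the diagram of Def. 1.7 -/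

namespace MuTwoSetting

variable (M : MuTwoSetting p)

/-- `[Π^tp_C : Π^tp_Ẍ] = 8` ("`Ẍ^log → C^log` is Galois, with Galois group isomorphic to `(ℤ/2ℤ)³`", p. 27:
`[Π^tp_X : Π^tp_Ẍ] = 4`, `[Π^tp_C : Π^tp_X] = 2`). [cite: MochizukiEtTh2009, Def 1.7 p.27] -/
theorem index_map_GtpXdd : (M.GtpXdd.map M.inclX).index = 8 := by
  rw [M.GtpXdd.index_map_of_injective M.injective_inclX, M.index_GtpXdd, M.index_range_inclX]

/-- `Ẍ^log → Ẋ^log` has degree `2` ("the quotient by the action of `ε_Z`", p. 27), for admissible `ε_Z`.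
[cite: MochizukiEtTh2009, Def 1.7 p.27] -/
theorem relIndex_map_GtpXdd_dotX {εZ : M.GtpC} (hZ : M.IsAdmissibleEpsZ εZ) :
    (M.GtpXdd.map M.inclX).relIndex (M.dotX εZ) = 2 := by
  rw [Subgroup.relIndex_eq_two_iff]
  refine ⟨εZ, Subgroup.mem_sup_right (Subgroup.mem_zpowers εZ), fun b hb => ?_⟩
  by_cases hbX : b ∈ M.GtpXdd.map M.inclX
  · refine Or.inr ⟨hbX, fun h => hZ.2.1 ?_⟩
    have := (M.GtpXdd.map M.inclX).mul_mem ((M.GtpXdd.map M.inclX).inv_mem hbX) h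
    rwa [inv_mul_cancel_left] at this
  · refine Or.inl ⟨?_, hbX⟩
    rcases (M.mem_dotX_iff εZ b).1 hb with h | h
    · exact absurd h hbX
    · have : b * εZ = b * εZ⁻¹ * (εZ * εZ) := by group
      rw [this]
      exact (M.GtpXdd.map M.inclX).mul_mem h (M.sq_mem_GtpXdd εZ)

/-- `[Π^tp_C : Π^tp_Ẋ] = 4` for admissible `ε_Z` (p. 27). [cite: MochizukiEtTh2009, Def 1.7 p.27] -/
theorem index_dotX {εZ : M.GtpC} (hZ : M.IsAdmissibleEpsZ εZ) : (M.dotX εZ).index = 4 := by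
  have h := Subgroup.relIndex_mul_index (M.map_GtpXdd_le_dotX εZ)
  rw [M.relIndex_map_GtpXdd_dotX hZ, M.index_map_GtpXdd] at h
  omega

/-- `Ẋ^log → X^log` has degree `2` ("the quotient by the action of `ε_μ`", p. 27), for admissible `ε_Z`.
[cite: MochizukiEtTh2009, Def 1.7 p.27] -/
theorem relIndex_dotX_range {εZ : M.GtpC} (hZ : M.IsAdmissibleEpsZ εZ) :
    (M.dotX εZ).relIndex M.inclX.range = 2 := by
  have h := Subgroup.relIndex_mul_index (M.dotX_le_range hZ)
  rw [M.index_dotX hZ, M.index_range_inclX] at h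
  omega

/-- `Ẋ^log → Ċ^log` has degree `2` ("the [stack-theoretic] quotient by the action of `ε_± · ε_μ`", p. 27),
for admissible `ε_Z`. [cite: MochizukiEtTh2009, Def 1.7 p.27] -/
theorem relIndex_dotX_dotC {εZ : M.GtpC} (hZ : M.IsAdmissibleEpsZ εZ) :
    (M.dotX εZ).relIndex (M.dotC εZ) = 2 := by
  rw [Subgroup.relIndex_eq_two_iff]
  refine ⟨M.epsPM * M.epsMu, Subgroup.mem_sup_right (Subgroup.mem_zpowers _), fun b hb => ?_⟩
  have hXC := M.dotX_le_range hZ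
  by_cases hbX : b ∈ M.dotX εZ
  · refine Or.inr ⟨hbX, fun h => M.epsPM_mul_epsMu_not_mem_range ?_⟩
    have := (M.dotX εZ).mul_mem ((M.dotX εZ).inv_mem hbX) h
    rw [inv_mul_cancel_left] at this
    exact hXC this
  · refine Or.inl ⟨?_, hbX⟩
    rcases (M.mem_dotC_iff εZ b).1 hb with h | h
    · exact absurd h hbX
    · have : b * (M.epsPM * M.epsMu) =
          b * (M.epsPM * M.epsMu)⁻¹ * ((M.epsPM * M.epsMu) * (M.epsPM * M.epsMu)) := by group
      rw [this]
      exact (M.dotX εZ).mul_mem h (M.map_GtpXdd_le_dotX εZ (M.sq_mem_GtpXdd _))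

/-- `[Π^tp_C : Π^tp_Ċ] = 2` (`Ċ^log → C^log` has degree `2`; p. 27), for admissible `ε_Z`.
[cite: MochizukiEtTh2009, Def 1.7 p.27] -/
theorem index_dotC {εZ : M.GtpC} (hZ : M.IsAdmissibleEpsZ εZ) : (M.dotC εZ).index = 2 := by
  have h := Subgroup.relIndex_mul_index (M.dotX_le_dotC εZ)
  rw [M.relIndex_dotX_dotC hZ, M.index_dotX hZ] at h
  omega

/-- `Π^tp_Ċ ≠ Π^tp_X` inside `Π^tp_C` (`Ċ` does not lie over `X`; p. 27), for admissible `ε_Z`.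
[cite: MochizukiEtTh2009, Def 1.7 p.27] -/
theorem dotC_ne_range {εZ : M.GtpC} (hZ : M.IsAdmissibleEpsZ εZ) : M.dotC εZ ≠ M.inclX.range := by
  intro h
  have := M.dotC_inf_range hZ
  rw [h, inf_idem] at this
  have h2 := M.relIndex_dotX_range hZ
  rw [← this, Subgroup.relIndex_self] at h2
  exact absurd h2 (by norm_num)

end MuTwoSetting

/-! ### Proposition 1.8 reduced to its anabelian inputs -/

section Prop18

variable {Mα Mβ : MuTwoSetting p} {εα : Mα.GtpC} {εβ : Mβ.GtpC}

/-- An isomorphism `γX : Π^tp_{Xα} →̃ Π^tp_{Xβ}` compatible with `Γ : Π^tp_{Cα} →̃ Π^tp_{Cβ}` transports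
images: `Γ(H) = γX(H)` inside `Π^tp_{Cβ}` for every `H ≤ Π^tp_{Xα}`. [cite: MochizukiEtTh2009, Prop 1.8 p.28] -/
theorem map_map_inclX_eq (Γ : Mα.GtpC ≃ₜ* Mβ.GtpC) (γX : Mα.PiTemp ≃ₜ* Mβ.PiTemp)
    (hγX : ∀ x, Mβ.inclX (γX.toMulEquiv x) = Γ.toMulEquiv (Mα.inclX x)) (H : Subgroup Mα.PiTemp) :
    (H.map Mα.inclX).map Γ.toMulEquiv.toMonoidHom = (H.map γX.toMulEquiv.toMonoidHom).map Mβ.inclX := by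
  rw [Subgroup.map_map, Subgroup.map_map]
  congr 1
  ext x
  simp only [MonoidHom.coe_comp, Function.comp_apply, MulEquiv.coe_toMonoidHom]
  exact (hγX x).symm

/-- Input (b) in the form it is used: `Γ(Π^tp_{Xα}) = Π^tp_{Xβ}`. [cite: MochizukiEtTh2009, Prop 1.8 p.28] -/
theorem map_range_inclX_eq (Γ : Mα.GtpC ≃ₜ* Mβ.GtpC) (γX : Mα.PiTemp ≃ₜ* Mβ.PiTemp)
    (hγX : ∀ x, Mβ.inclX (γX.toMulEquiv x) = Γ.toMulEquiv (Mα.inclX x)) :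
    Mα.inclX.range.map Γ.toMulEquiv.toMonoidHom = Mβ.inclX.range := by
  rw [MonoidHom.range_eq_map, MonoidHom.range_eq_map, map_map_inclX_eq Γ γX hγX]
  congr 1
  refine le_antisymm le_top fun x _ => ⟨γX.toMulEquiv.symm x, trivial, ?_⟩
  simp

/-- **Modulo Thm. 1.6 (i) and compatibility with `Π^tp_X`, preserving the diagram of coverings is
EQUIVALENT to preserving `Π^tp_Ċ`**: for admissible `ε_{Z,α}, ε_{Z,β}`, `Γ : Π^tp_{Cα} →̃ Π^tp_{Cβ}`, and
`γX : Π^tp_{Xα} →̃ Π^tp_{Xβ}` with `inclX ∘ γX = Γ ∘ inclX` satisfying Thm. 1.6 (i), one has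
`PreservesCoverings ε_{Z,α} ε_{Z,β} Γ ↔ Γ(Π^tp_{Ċα}) = Π^tp_{Ċβ}` — the clauses for `Π^tp_X`, `Π^tp_Ÿ`,
`Π^tp_Ẍ`, `Π^tp_Ẋ` being PROVED (pp. 28–29). [cite: MochizukiEtTh2009, Prop 1.8 p.28] -/
theorem preservesCoverings_iff_map_dotC (hα : Mα.IsAdmissibleEpsZ εα) (hβ : Mβ.IsAdmissibleEpsZ εβ)
    (Γ : Mα.GtpC ≃ₜ* Mβ.GtpC) (γX : Mα.PiTemp ≃ₜ* Mβ.PiTemp)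
    (hγX : ∀ x, Mβ.inclX (γX.toMulEquiv x) = Γ.toMulEquiv (Mα.inclX x))
    (h16 : ThetaSetting.Thm16i γX) :
    PreservesCoverings εα εβ Γ ↔ (Mα.dotC εα).map Γ.toMulEquiv.toMonoidHom = Mβ.dotC εβ := by
  refine ⟨fun h => h.map_dotC, fun hC => ?_⟩
  have hX := map_range_inclX_eq Γ γX hγX
  have hYdd : (Mα.GtpYdd.map Mα.inclX).map Γ.toMulEquiv.toMonoidHom = Mβ.GtpYdd.map Mβ.inclX := by
    rw [map_map_inclX_eq Γ γX hγX]
    exact congrArg (Subgroup.map Mβ.inclX) h16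
  have hXdd : (Mα.GtpXdd.map Mα.inclX).map Γ.toMulEquiv.toMonoidHom = Mβ.GtpXdd.map Mβ.inclX := by
    rw [map_map_inclX_eq Γ γX hγX]
    exact congrArg (Subgroup.map Mβ.inclX)
      (MuTwoSetting.map_GtpXdd_eq_of_map_GtpYdd_eq γX.toMulEquiv h16)
  have hdotX : (Mα.dotX εα).map Γ.toMulEquiv.toMonoidHom = Mβ.dotX εβ := by
    rw [← Mα.dotC_inf_range hα, ← Mβ.dotC_inf_range hβ,
      Subgroup.map_inf_eq _ _ _ Γ.toMulEquiv.injective, hC, hX]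
  exact ⟨hYdd, hXdd, hdotX, hX, hC⟩

/-- **The field `preserves` of `Thm110Hypothesis` is implied by its other fields**: an extension `Γ` of
`γ : Π^tp_{Ċα} →̃ Π^tp_{Ċβ}` up to an inner automorphism, compatible with `Π^tp_X` through an isomorphism
`γX` satisfying Thm. 1.6 (i), preserves the whole diagram of coverings (pp. 28–29).
[cite: MochizukiEtTh2009, Prop 1.8 p.28] -/
theorem preservesCoverings_of_extension (hα : Mα.IsAdmissibleEpsZ εα) (hβ : Mβ.IsAdmissibleEpsZ εβ)
    (γ : Mα.dotC εα ≃ₜ* Mβ.dotC εβ) (Γ : Mα.GtpC ≃ₜ* Mβ.GtpC)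
    (hres : ∃ c : Mβ.GtpC, ∀ x : Mα.dotC εα, Γ.toMulEquiv x.1 = c * (γ.toMulEquiv x).1 * c⁻¹)
    (γX : Mα.PiTemp ≃ₜ* Mβ.PiTemp)
    (hγX : ∀ x, Mβ.inclX (γX.toMulEquiv x) = Γ.toMulEquiv (Mα.inclX x))
    (h16 : ThetaSetting.Thm16i γX) : PreservesCoverings εα εβ Γ := by
  obtain ⟨c, hc⟩ := hres
  haveI := Mβ.dotC_normal εβ
  exact (preservesCoverings_iff_map_dotC hα hβ Γ γX hγX h16).2
    (map_eq_of_forall_eq_conj Γ.toMulEquiv γ.toMulEquiv hc)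

/-- **Prop. 1.8, the `Ċ`-case, modulo its anabelian inputs** (pp. 28–29): given (a) an extension
`Γ : Π^tp_{Cα} →̃ Π^tp_{Cβ}` of `γ : Π^tp_{Ċα} →̃ Π^tp_{Ċβ}` up to an inner automorphism ([SemiAnbd] Thm. 6.8
(ii) + condition (II)), (b) an isomorphism `γX : Π^tp_{Xα} →̃ Π^tp_{Xβ}` induced by `Γ` ([AbsCusp] Lem.
2.1 (v), [AbsAnab] Lem. 1.3.8), (d) Thm. 1.6 (i) for `γX` — `Prop18pm` holds; the remaining clauses
(`Π^tp_Ċ`, `Π^tp_Ẋ = Π^tp_Ċ ∩ Π^tp_X`, `Π^tp_Ẍ`, `Π^tp_Ÿ`) are PROVED. [cite: MochizukiEtTh2009, Prop 1.8 p.28] -/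
theorem prop18pm_of_extension (hα : Mα.IsAdmissibleEpsZ εα) (hβ : Mβ.IsAdmissibleEpsZ εβ)
    (γ : Mα.dotC εα ≃ₜ* Mβ.dotC εβ) (Γ : Mα.GtpC ≃ₜ* Mβ.GtpC)
    (hres : ∃ c : Mβ.GtpC, ∀ x : Mα.dotC εα, Γ.toMulEquiv x.1 = c * (γ.toMulEquiv x).1 * c⁻¹)
    (γX : Mα.PiTemp ≃ₜ* Mβ.PiTemp)
    (hγX : ∀ x, Mβ.inclX (γX.toMulEquiv x) = Γ.toMulEquiv (Mα.inclX x))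
    (h16 : ThetaSetting.Thm16i γX) : Prop18pm hα hβ γ :=
  ⟨Γ, preservesCoverings_of_extension hα hβ γ Γ hres γX hγX h16, hres⟩

/-- **Prop. 1.8, the `Ẋ`-case, modulo its anabelian inputs** (pp. 28–29): given (a) an extension
`Γ : Π^tp_{Cα} →̃ Π^tp_{Cβ}` of `γ : Π^tp_{Ẋα} →̃ Π^tp_{Ẋβ}` up to an inner automorphism ([SemiAnbd] Thm. 6.8
(ii) + condition (II)), (b) an isomorphism `γX : Π^tp_{Xα} →̃ Π^tp_{Xβ}` induced by `Γ` ([AbsCusp] Lem.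
2.1 (v), [AbsAnab] Lem. 1.3.8), (c) `Γ(Π^tp_{Ċα}) = Π^tp_{Ċβ}` (the cusp characterization of `Ẋ → Ċ`),
(d) Thm. 1.6 (i) for `γX` — `Prop18` holds; the clauses for `Π^tp_Ẋ`, `Π^tp_X`, `Π^tp_Ẍ`, `Π^tp_Ÿ` are
PROVED. [cite: MochizukiEtTh2009, Prop 1.8 p.28] -/
theorem prop18_of_extension (hα : Mα.IsAdmissibleEpsZ εα) (hβ : Mβ.IsAdmissibleEpsZ εβ)
    (γ : Mα.dotX εα ≃ₜ* Mβ.dotX εβ) (Γ : Mα.GtpC ≃ₜ* Mβ.GtpC)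
    (hres : ∃ c : Mβ.GtpC, ∀ x : Mα.dotX εα, Γ.toMulEquiv x.1 = c * (γ.toMulEquiv x).1 * c⁻¹)
    (γX : Mα.PiTemp ≃ₜ* Mβ.PiTemp)
    (hγX : ∀ x, Mβ.inclX (γX.toMulEquiv x) = Γ.toMulEquiv (Mα.inclX x))
    (h16 : ThetaSetting.Thm16i γX)
    (hC : (Mα.dotC εα).map Γ.toMulEquiv.toMonoidHom = Mβ.dotC εβ) : Prop18 hα hβ γ :=
  ⟨Γ, (preservesCoverings_iff_map_dotC hα hβ Γ γX hγX h16).2 hC, hres⟩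

/-- In the `Ẋ`-case the extension clause alone already gives `Γ(Π^tp_{Ẋα}) = Π^tp_{Ẋβ}` (normality of
`Π^tp_Ẋ` in `Π^tp_C`), independently of (b)–(d). [cite: MochizukiEtTh2009, Prop 1.8 p.28] -/
theorem map_dotX_eq_of_extension (γ : Mα.dotX εα ≃ₜ* Mβ.dotX εβ) (Γ : Mα.GtpC ≃ₜ* Mβ.GtpC)
    (hres : ∃ c : Mβ.GtpC, ∀ x : Mα.dotX εα, Γ.toMulEquiv x.1 = c * (γ.toMulEquiv x).1 * c⁻¹) :
    (Mα.dotX εα).map Γ.toMulEquiv.toMonoidHom = Mβ.dotX εβ := by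
  obtain ⟨c, hc⟩ := hres
  haveI := Mβ.dotX_normal εβ
  exact map_eq_of_forall_eq_conj Γ.toMulEquiv γ.toMulEquiv hc

end Prop18

end Literature.AnabelianGeometry.EtaleTheta

/-! ### Non-vacuity of the choice of `ε_Z` in Def. 1.7 (appended)

"Now suppose that we are given a nontrivial element `ε_Z ∈ Gal(Ẍ/X)` which is `≠ ε_μ`" (p. 27): such an
element EXISTS in every `MuTwoSetting` (`Gal(Ẍ/X)` has order `4`), so the predicates `IsOfTypeOneMuTwo`,
`IsOfTypeOneMuTwoPM` ("of type `(1, μ₂)`", "of type `(1, μ₂)±`") are inhabited; and the other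
admissible choice is `ε_Z ε_μ`. -/

namespace Literature.AnabelianGeometry.EtaleTheta

namespace MuTwoSetting

variable {p : ℕ} [Fact p.Prime] (M : MuTwoSetting p)

/-- For ANY `e ∈ Π^tp_C` outside `Π^tp_Ẍ`: `[Π^tp_Ẍ · ⟨e⟩ : Π^tp_Ẍ] = 2` (`e² ∈ Π^tp_Ẍ`; p. 27).
[cite: MochizukiEtTh2009, Def 1.7 p.27] -/
theorem relIndex_map_GtpXdd_dotX_of_not_mem {e : M.GtpC} (he : e ∉ M.GtpXdd.map M.inclX) :
    (M.GtpXdd.map M.inclX).relIndex (M.dotX e) = 2 := by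
  rw [Subgroup.relIndex_eq_two_iff]
  refine ⟨e, Subgroup.mem_sup_right (Subgroup.mem_zpowers e), fun b hb => ?_⟩
  by_cases hbX : b ∈ M.GtpXdd.map M.inclX
  · refine Or.inr ⟨hbX, fun h => he ?_⟩
    have := (M.GtpXdd.map M.inclX).mul_mem ((M.GtpXdd.map M.inclX).inv_mem hbX) h
    rwa [inv_mul_cancel_left] at this
  · refine Or.inl ⟨?_, hbX⟩
    rcases (M.mem_dotX_iff e b).1 hb with h | h
    · exact absurd h hbX
    · have : b * e = b * e⁻¹ * (e * e) := by group
      rw [this]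
      exact (M.GtpXdd.map M.inclX).mul_mem h (M.sq_mem_GtpXdd e)

/-- **An admissible `ε_Z` exists** ("a nontrivial element `ε_Z ∈ Gal(Ẍ/X)` which is `≠ ε_μ`", p. 27):
otherwise `Π^tp_X = Π^tp_Ẍ · ⟨ε_μ⟩` would have index `8/2 = 4 ≠ 2` in `Π^tp_C`. Non-vacuity of the
hypotheses `IsAdmissibleEpsZ` of Prop. 1.8 / Thm. 1.10. [cite: MochizukiEtTh2009, Def 1.7 p.27] -/
theorem exists_isAdmissibleEpsZ : ∃ εZ : M.GtpC, M.IsAdmissibleEpsZ εZ := by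
  by_contra hne
  push Not at hne
  have hX : M.inclX.range ≤ M.dotX M.epsMu := by
    intro g hg
    rw [M.mem_dotX_iff]
    by_contra hcon
    push Not at hcon
    exact hne g ⟨hg, hcon.1, hcon.2⟩
  have hle : M.dotX M.epsMu ≤ M.inclX.range :=
    sup_le M.map_GtpXdd_le_range (Subgroup.zpowers_le.2 M.epsMu_mem)
  have heq : M.dotX M.epsMu = M.inclX.range := le_antisymm hle hX
  have h := Subgroup.relIndex_mul_index (M.map_GtpXdd_le_dotX M.epsMu)
  rw [M.relIndex_map_GtpXdd_dotX_of_not_mem M.epsMu_not_mem, M.index_map_GtpXdd, heq,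
    M.index_range_inclX] at h
  omega

variable {M} in
/-- **The other admissible choice**: with `ε_Z`, also `ε_Z ε_μ` is a nontrivial element of `Gal(Ẍ/X)`
different from `ε_μ` (p. 27). [cite: MochizukiEtTh2009, Def 1.7 p.27] -/
theorem IsAdmissibleEpsZ.mul_epsMu {εZ : M.GtpC} (hZ : M.IsAdmissibleEpsZ εZ) :
    M.IsAdmissibleEpsZ (εZ * M.epsMu) := by
  refine ⟨M.inclX.range.mul_mem hZ.1 M.epsMu_mem, fun h => hZ.2.2 ?_, ?_⟩
  · have : εZ * M.epsMu⁻¹ = εZ * M.epsMu * (M.epsMu * M.epsMu)⁻¹ := by group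
    rw [this]
    exact (M.GtpXdd.map M.inclX).mul_mem h ((M.GtpXdd.map M.inclX).inv_mem (M.sq_mem_GtpXdd _))
  · rw [mul_inv_cancel_right]
    exact hZ.2.1

/-- "Of type `(1, μ₂)`" is inhabited: some `Π^tp_Ẋ ≤ Π^tp_C` is of type `(1, μ₂)` (Def. 1.7, p. 27).
[cite: MochizukiEtTh2009, Def 1.7 p.27] -/
theorem exists_isOfTypeOneMuTwo : ∃ H : Subgroup M.GtpC, M.IsOfTypeOneMuTwo H := by
  obtain ⟨εZ, hZ⟩ := M.exists_isAdmissibleEpsZ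
  exact ⟨M.dotX εZ, εZ, hZ, rfl⟩

/-- "Of type `(1, μ₂)±`" is inhabited: some `Π^tp_Ċ ≤ Π^tp_C` is of type `(1, μ₂)±` (Def. 1.7, p. 27).
[cite: MochizukiEtTh2009, Def 1.7 p.27] -/
theorem exists_isOfTypeOneMuTwoPM : ∃ H : Subgroup M.GtpC, M.IsOfTypeOneMuTwoPM H := by
  obtain ⟨εZ, hZ⟩ := M.exists_isAdmissibleEpsZ
  exact ⟨M.dotC εZ, εZ, hZ, rfl⟩

end MuTwoSetting

end Literature.AnabelianGeometry.EtaleTheta
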